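import Literature.Probability.RandomPlanarGeometry.CaratheodoryExtension
import Literature.Probability.RandomPlanarGeometry.CaratheodoryLC
import Literature.Topology.PlaneTopology.JordanCurveProofs
import HarnessLib

/-!
# One-sided boundary points have one preimage under the Carathéodory extension
# (piece (M3c) of stub 5a4″ `stub_carvedReduction_squeezeSolid`)

Piece of stub 5a4″ `stub_carvedReduction_squeezeSolid`
(`TwoPieceAdmRestrictionLimit → MovingCarvingSqueezeP FatAnchoredClassZeroSolid`) of the line
`bridge-gate-renewal` (r10) of the crux `SAWDefectDecoherence.ObservableToSLER`
(stmt-CriticalPhenomena-14005; twin T-A `stub_carvedReduction_squeezeGeometry` of stmt-CriticalPhenomena-10472),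
clause (C2).  The boundary loop of the inner domain is tracked against `D.boundary` through the
continuous extension `ψ̄` of a uniformizer `ψ : 𝔻 → Ω*` of the LIMIT BULK (it exists:
`…SqueezeBoundaryLC` + Literature `CaratheodoryLC`); the far boundary points `D.boundary t - τ` of
`Ω*` must have ONE `ψ̄`-preimage `ξ(t)` for the parametrisation `t ↦ ψ̄(ξ(t) pushed in)` to make
sense.  `Ω*` has pinch points (several preimages), but the far points are not cut points of the
complement, and that suffices:

* `eq_of_extendFrom_eq_of_nonCut` — for a conformal equivalence `ψ : 𝔻 → G` onto a bounded open
  `G` whose extension is continuous on the closed disc (with the limit property), two points of the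
  unit circle with the same image `w` coincide as soon as `Gᶜ ∖ {w}` is CONNECTED.  Proof: the
  injectivity step of Carathéodory's theorem (`JordanDomain.injOn_extendFrom_sphere`,
  CaratheodoryExtension.lean step 6) with "the exterior of `D` is connected, unbounded and
  accumulates at `∂D`" replaced by "`Gᶜ ∖ {w}` is connected, unbounded and misses the loop of the
  two radii": one sector maps inside that loop, the extension is constant on an arc, boundary
  uniqueness makes `ψ` constant, absurd.
* `stub_carvedReduction_oneSidedInjective` — the registry form with the uniform-continuum hypothesis
  `hlc` (continuity of the extension from `ConformalEquiv.continuousOn_extendFrom_of_lc`).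
* `isPreconnected_diff_singleton_of_local` — the non-cut-point criterion the squeeze uses (one
  neighbourhood `V` of `w` with `V ∖ {w}` preconnected suffices; `V` = the Schoenflies image of a
  small closed half-disc about the far boundary point, which misses the carvings).

Sources: Ch. Pommerenke, Boundary Behaviour of Conformal Maps (1992), Thms. 2.1, 2.6.
-/

noncomputable section
open Set Filter Metric Topology Complex Real
open scoped NNReal
open Literature.Probability.RandomPlanarGeometry
open Literature.Topology.PlaneTopology (JordanCurveTheorem_holds)

namespace Summit.CriticalPhenomena.SAWScalingLimit.Theorems.ObservableToSLER.Squeeze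

/-- **Non-cut points from one good neighbourhood.**  If `X` is preconnected and `w ∈ V ⊆ X` with
`V` a neighbourhood of `w` in `X` and `V ∖ {w}` preconnected, then `X ∖ {w}` is preconnected. -/
theorem isPreconnected_diff_singleton_of_local {X V : Set ℂ} {w : ℂ} (hX : IsPreconnected X)
    (hVX : V ⊆ X) (hwV : w ∈ V) (hVn : V ∈ 𝓝[X] w) (hV : IsPreconnected (V \ {w})) :
    IsPreconnected (X \ {w}) := by
  obtain ⟨O, hO, hwO, hOV⟩ : ∃ O : Set ℂ, IsOpen O ∧ w ∈ O ∧ O ∩ X ⊆ V := mem_nhdsWithin.1 hVn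
  set S : Set ℂ := X \ {w} with hS
  -- key: if `V ∖ {w}` lies in the side `u` of an open separation `(u, v)` of `S`, then `S ∩ v = ∅`
  have key : ∀ u v : Set ℂ, IsOpen u → IsOpen v → S ⊆ u ∪ v → S ∩ (u ∩ v) = ∅ → V \ {w} ⊆ u →
      S ∩ v = ∅ := by
    intro u v hu hv hcov hdisj hVu
    by_contra hne
    obtain ⟨b₀, hb₀⟩ := Set.nonempty_iff_ne_empty.2 hne
    set B : Set ℂ := S ∩ v with hB
    have hBV : ∀ b ∈ B, b ∉ V := fun b hb hbV =>
      (eq_empty_iff_forall_notMem.1 hdisj) b ⟨hb.1, hVu ⟨hbV, hb.1.2⟩, hb.2⟩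
    have hwB : w ∉ closure B := fun h => by
      obtain ⟨b, hbO, hbB⟩ := mem_closure_iff_nhds.1 h O (hO.mem_nhds hwO)
      exact hBV b hbB (hOV ⟨hbO, hbB.1.1⟩)
    have hclB : closure B ∩ X ⊆ B := by
      rintro z ⟨hzcl, hzX⟩
      have hzw : z ≠ w := fun h => hwB (h ▸ hzcl)
      rcases hcov ⟨hzX, hzw⟩ with hzu | hzv
      · obtain ⟨b, hbu, hbB⟩ := mem_closure_iff_nhds.1 hzcl u (hu.mem_nhds hzu)
        exact ((eq_empty_iff_forall_notMem.1 hdisj) b ⟨hbB.1, hbu, hbB.2⟩).elim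
      · exact ⟨⟨hzX, hzw⟩, hzv⟩
    have hvw : IsOpen (v \ {w}) := hv.sdiff isClosed_singleton
    have hXcov : X ⊆ (v \ {w}) ∪ (closure B)ᶜ := fun z hz => by
      by_cases hzB : z ∈ closure B
      · have hb := hclB ⟨hzB, hz⟩
        exact Or.inl ⟨hb.2, hb.1.2⟩
      · exact Or.inr hzB
    have h1 : (X ∩ (v \ {w})).Nonempty := ⟨b₀, hb₀.1.1, hb₀.2, hb₀.1.2⟩
    have h2 : (X ∩ (closure B)ᶜ).Nonempty := ⟨w, hVX hwV, hwB⟩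
    obtain ⟨z, hzX, ⟨hzv, hzw⟩, hzB⟩ := hX _ _ hvw isClosed_closure.isOpen_compl hXcov h1 h2
    exact hzB (subset_closure ⟨⟨hzX, hzw⟩, hzv⟩)
  rw [isPreconnected_iff_subset_of_disjoint]
  intro u v hu hv hcov hdisj
  have hVcov : V \ {w} ⊆ u ∪ v := (Set.sdiff_subset_sdiff_left hVX).trans hcov
  have hVdisj : (V \ {w}) ∩ (u ∩ v) = ∅ := by
    rw [← subset_empty_iff, ← hdisj]
    exact inter_subset_inter_left _ (Set.sdiff_subset_sdiff_left hVX)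
  rcases (isPreconnected_iff_subset_of_disjoint.1 hV) u v hu hv hVcov hVdisj with hVu | hVv
  · left
    intro z hz
    rcases hcov hz with h | h
    · exact h
    · exact ((eq_empty_iff_forall_notMem.1 (key u v hu hv hcov hdisj hVu)) z ⟨hz, h⟩).elim
  · right
    intro z hz
    rcases hcov hz with h | h
    · refine ((eq_empty_iff_forall_notMem.1 (key v u hv hu ?_ ?_ hVv)) z ⟨hz, h⟩).elim
      · rwa [union_comm]
      · rwa [inter_comm v u]
    · exact h

section Extension

variable {G : Set ℂ} (φ : ConformalEquiv (ball (0 : ℂ) 1) G)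

/-- The extension maps the unit circle into `∂G` (given the limit property at the point). -/
theorem extendFrom_mem_frontier' (hG : IsOpen G) {x : ℂ} (hx : ‖x‖ = 1)
    (htend : Tendsto φ (𝓝[ball 0 1] x) (𝓝 (extendFrom (ball 0 1) φ x))) :
    extendFrom (ball 0 1) φ x ∈ frontier G := by
  have hxcl : x ∈ closure (ball (0 : ℂ) 1) := by
    rw [closure_ball 0 one_ne_zero]; exact mem_closedBall_zero_iff.2 hx.le
  haveI : (𝓝[ball (0 : ℂ) 1] x).NeBot := mem_closure_iff_nhdsWithin_neBot.1 hxcl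
  have hcl : extendFrom (ball 0 1) φ x ∈ closure G :=
    mem_closure_of_tendsto htend (eventually_mem_nhdsWithin.mono fun z hz ↦ φ.mapsTo hz)
  rw [hG.frontier_eq]
  refine ⟨hcl, fun haG ↦ ?_⟩
  have hsymm : ContinuousAt φ.symm (extendFrom (ball 0 1) φ x) :=
    (φ.symm.continuousOn _ haG).continuousAt (hG.mem_nhds haG)
  have h1 : Tendsto (fun z ↦ φ.symm (φ z)) (𝓝[ball 0 1] x) (𝓝 (φ.symm (extendFrom (ball 0 1) φ x))) :=
    hsymm.tendsto.comp htend
  have h2 : Tendsto (fun z ↦ φ.symm (φ z)) (𝓝[ball 0 1] x) (𝓝 x) :=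
    (tendsto_id.mono_left nhdsWithin_le_nhds).congr'
      (eventually_mem_nhdsWithin.mono fun z hz ↦ (φ.symm_apply_apply hz).symm)
  have heq := tendsto_nhds_unique h1 h2
  have hmem := φ.symm_mapsTo haG
  rw [heq, mem_ball_zero_iff, hx] at hmem
  exact lt_irrefl _ hmem

/-- Radial limits of the extension: `Φ (ρ e) → Φ e` as `ρ → 1⁻` (`‖e‖ = 1`), given continuity of
the extension on the closed disc. -/
theorem tendsto_extendFrom_radial' (hΦc : ContinuousOn (extendFrom (ball 0 1) φ) (closedBall (0 : ℂ) 1))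
    {e : ℂ} (he : ‖e‖ = 1) :
    Tendsto (fun ρ : ℝ ↦ extendFrom (ball 0 1) φ ((ρ : ℂ) * e)) (𝓝[<] 1)
      (𝓝 (extendFrom (ball 0 1) φ e)) := by
  have hcont := hΦc e (mem_closedBall_zero_iff.2 he.le)
  have hpath : Tendsto (fun ρ : ℝ ↦ (ρ : ℂ) * e) (𝓝[<] 1) (𝓝[closedBall (0 : ℂ) 1] e) := by
    refine tendsto_nhdsWithin_iff.2 ⟨?_, ?_⟩
    · have : Tendsto (fun ρ : ℝ ↦ (ρ : ℂ) * e) (𝓝 1) (𝓝 ((1 : ℝ) * e)) :=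
        ((continuous_ofReal.tendsto 1).mul tendsto_const_nhds)
      rw [ofReal_one, one_mul] at this
      exact this.mono_left nhdsWithin_le_nhds
    · filter_upwards [Ioo_mem_nhdsLT one_pos] with ρ hρ
      rw [mem_closedBall_zero_iff, norm_mul, he, mul_one, Complex.norm_real, Real.norm_eq_abs,
        abs_of_pos hρ.1]
      exact hρ.2.le
  exact hcont.tendsto.comp hpath

/-- **One preimage at non-cut points.**  Let `φ : 𝔻 → G` be a conformal equivalence onto a bounded
open `G` whose extension is continuous on the closed disc and is the limit of `φ` at every point of
the closed disc.  If `‖x‖ = ‖x'‖ = 1` have the same image `w` and `Gᶜ ∖ {w}` is connected, then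
`x = x'`. [cite: PommerenkeBBCM1992, Thm. 2.6 (injectivity step)] -/
theorem eq_of_extendFrom_eq_of_nonCut (hG : IsOpen G) (hGb : Bornology.IsBounded G)
    (hΦc : ContinuousOn (extendFrom (ball 0 1) φ) (closedBall (0 : ℂ) 1))
    (htend : ∀ x ∈ closedBall (0 : ℂ) 1, Tendsto φ (𝓝[ball 0 1] x) (𝓝 (extendFrom (ball 0 1) φ x)))
    {x x' : ℂ} (hx1 : ‖x‖ = 1) (hx1' : ‖x'‖ = 1)
    (hw : extendFrom (ball 0 1) φ x = extendFrom (ball 0 1) φ x')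
    (hcut : IsConnected (Gᶜ \ {extendFrom (ball 0 1) φ x})) : x = x' := by
  set Φ := extendFrom (ball 0 1) φ with hΦ
  by_contra hne
  set w := Φ x with hwdef
  have hwJ : w ∈ frontier G :=
    extendFrom_mem_frontier' φ hG hx1 (htend x (mem_closedBall_zero_iff.2 hx1.le))
  obtain ⟨θ₁, θ₂, hxθ, hx'θ, h12, h21⟩ := exists_angles hx1 hx1' hne
  have hrad : ∀ {e : ℂ}, ‖e‖ = 1 → ∀ s ∈ Ico (0 : ℝ) 1, (s : ℂ) * e ∈ ball (0 : ℂ) 1 := fun he s hs ↦ by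
    rw [mem_ball_zero_iff, norm_mul, he, mul_one, Complex.norm_real, Real.norm_eq_abs, abs_of_nonneg hs.1]
    exact hs.2
  have hrad' : ∀ {e : ℂ}, ‖e‖ = 1 → ∀ s ∈ Icc (0 : ℝ) 1, (s : ℂ) * e ∈ closedBall (0 : ℂ) 1 := fun he s hs ↦ by
    rw [mem_closedBall_zero_iff, norm_mul, he, mul_one, Complex.norm_real, Real.norm_eq_abs, abs_of_nonneg hs.1]
    exact hs.2
  -- the two radii `p` (from `φ 0` to `w` along `x`) and `q` (from `w` to `φ 0` along `x'`)
  set p : ℝ → ℂ := fun s ↦ Φ ((s : ℂ) * x) with hp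
  set q : ℝ → ℂ := fun s ↦ Φ (((1 - s : ℝ) : ℂ) * x') with hq
  have hpc : ContinuousOn p (Icc 0 1) := hΦc.comp (by fun_prop) (hrad' hx1)
  have hqc : ContinuousOn q (Icc 0 1) :=
    hΦc.comp (by fun_prop) fun s hs ↦ hrad' hx1' (1 - s) ⟨by linarith [hs.2], by linarith [hs.1]⟩
  have hp_lt : ∀ s ∈ Ico (0 : ℝ) 1, p s = φ ((s : ℂ) * x) := fun s hs ↦
    extendFrom_extends φ.continuousOn _ (hrad hx1 s hs)
  have hq_gt : ∀ s ∈ Ioc (0 : ℝ) 1, q s = φ (((1 - s : ℝ) : ℂ) * x') := fun s hs ↦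
    extendFrom_extends φ.continuousOn _ (hrad hx1' (1 - s) ⟨by linarith [hs.2], by linarith [hs.1]⟩)
  have hΦ0 : Φ 0 = φ 0 := extendFrom_extends φ.continuousOn _ (mem_ball_self one_pos)
  have hp1 : p 1 = w := by simp [hp, hwdef]
  have hq0 : q 0 = w := by simp only [hq, sub_zero, ofReal_one, one_mul]; exact hw.symm
  have hp0 : p 0 = φ 0 := by simp only [hp, ofReal_zero, zero_mul]; exact hΦ0
  have hq1 : q 1 = φ 0 := by simp only [hq, sub_self, ofReal_zero, zero_mul]; exact hΦ0
  have hpΩ : ∀ s ∈ Ico (0 : ℝ) 1, p s ∈ G := fun s hs ↦ by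
    rw [hp_lt s hs]; exact φ.mapsTo (hrad hx1 s hs)
  have hqΩ : ∀ s ∈ Ioc (0 : ℝ) 1, q s ∈ G := fun s hs ↦ by
    rw [hq_gt s hs]; exact φ.mapsTo (hrad hx1' (1 - s) ⟨by linarith [hs.2], by linarith [hs.1]⟩)
  have hwΩ : w ∉ G := fun h => by
    have h' := hwJ; rw [hG.frontier_eq] at h'; exact h'.2 h
  have hx0 : x ≠ 0 := by rintro rfl; simp at hx1
  have hx0' : x' ≠ 0 := by rintro rfl; simp at hx1'
  have hpinj : InjOn p (Icc 0 1) := by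
    intro s hs s' hs' h
    rcases eq_or_lt_of_le hs.2 with rfl | hs1 <;> rcases eq_or_lt_of_le hs'.2 with h' | hs1'
    · exact h'.symm
    · exact absurd (hpΩ s' ⟨hs'.1, hs1'⟩) (by rw [← h, hp1]; exact hwΩ)
    · exact absurd (hpΩ s ⟨hs.1, hs1⟩) (by rw [h, h', hp1]; exact hwΩ)
    · rw [hp_lt s ⟨hs.1, hs1⟩, hp_lt s' ⟨hs'.1, hs1'⟩] at h
      have := φ.injOn (hrad hx1 s ⟨hs.1, hs1⟩) (hrad hx1 s' ⟨hs'.1, hs1'⟩) h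
      exact_mod_cast mul_right_cancel₀ hx0 this
  have hqinj : InjOn q (Icc 0 1) := by
    intro s hs s' hs' h
    rcases eq_or_lt_of_le hs.1 with h0 | hs0 <;> rcases eq_or_lt_of_le hs'.1 with h0' | hs0'
    · rw [← h0, ← h0']
    · exact absurd (hqΩ s' ⟨hs0', hs'.2⟩) (by rw [← h, ← h0, hq0]; exact hwΩ)
    · exact absurd (hqΩ s ⟨hs0, hs.2⟩) (by rw [h, ← h0', hq0]; exact hwΩ)
    · rw [hq_gt s ⟨hs0, hs.2⟩, hq_gt s' ⟨hs0', hs'.2⟩] at h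
      have := φ.injOn (hrad hx1' (1 - s) ⟨by linarith [hs.2], by linarith⟩)
        (hrad hx1' (1 - s') ⟨by linarith [hs'.2], by linarith⟩) h
      have := mul_right_cancel₀ hx0' this
      have : (1 - s : ℝ) = 1 - s' := by exact_mod_cast this
      linarith
  have hqp : ∀ s ∈ Ioo (0 : ℝ) 1, ∀ s' ∈ Icc (0 : ℝ) 1, q s ≠ p s' := by
    intro s hs s' hs' h
    rcases eq_or_lt_of_le hs'.2 with h1 | hs1'
    · exact hwΩ (by rw [← hp1, ← h1, ← h]; exact hqΩ s ⟨hs.1, hs.2.le⟩)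
    · rw [hq_gt s ⟨hs.1, hs.2.le⟩, hp_lt s' ⟨hs'.1, hs1'⟩] at h
      have heq := φ.injOn (hrad hx1' (1 - s) ⟨by linarith [hs.2], by linarith [hs.1]⟩)
        (hrad hx1 s' ⟨hs'.1, hs1'⟩) h
      have hn := congrArg norm heq
      simp only [norm_mul, Complex.norm_real, Real.norm_eq_abs, hx1, hx1', mul_one,
        abs_of_pos (by linarith [hs.2] : (0 : ℝ) < 1 - s), abs_of_nonneg hs'.1] at hn
      rw [hn] at heq
      have hs'0 : (s' : ℂ) ≠ 0 := ofReal_ne_zero.2 (by linarith [hs.2])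
      exact hne (mul_left_cancel₀ hs'0 heq).symm
  -- the Jordan curve `E' = p [0,1] ∪ q [0,1]` and its complementary components
  obtain ⟨γ, hγc, hγp, hγi, hγr⟩ :=
    exists_periodic_of_two_arcs hpc hqc hpinj hqinj (hp1.trans hq0.symm) (hq1.trans hp0.symm) hqp
  obtain ⟨U₁, U₂, hU₁o, hU₂o, -, -, hdisj, hunion, hfr₁, hfr₂, hU₁b, -⟩ :=
    JordanCurveTheorem_holds.of_periodic hγc hγp hγi
  rw [hγr] at hunion hfr₁ hfr₂
  set E := p '' Icc 0 1 ∪ q '' Icc 0 1 with hE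
  have hEsub : E ⊆ G ∪ {w} := by
    rintro z (⟨s, hs, rfl⟩ | ⟨s, hs, rfl⟩)
    · rcases eq_or_lt_of_le hs.2 with rfl | hs1
      · exact Or.inr hp1
      · exact Or.inl (hpΩ s ⟨hs.1, hs1⟩)
    · rcases eq_or_lt_of_le hs.1 with h0 | hs0
      · exact Or.inr (by rw [← h0]; exact hq0)
      · exact Or.inl (hqΩ s ⟨hs0, hs.2⟩)
  -- `Gᶜ ∖ {w}` is connected, unbounded and misses `E`, so lies in the unbounded component;
  -- hence `∂G` misses the bounded component `U₁`
  have hXE : Gᶜ \ {w} ⊆ U₁ ∪ U₂ := by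
    rw [hunion]
    exact fun z hz hzE ↦ (hEsub hzE).elim hz.1 hz.2
  have hXU₂ : Gᶜ \ {w} ⊆ U₂ := by
    rcases hcut.isPreconnected.subset_or_subset hU₁o hU₂o hdisj hXE with h | h
    · exfalso
      have hb : Bornology.IsBounded (Gᶜ \ {w}) := hU₁b.subset h
      have hsub : (univ : Set ℂ) ⊆ G ∪ ((Gᶜ \ {w}) ∪ {w}) := fun z _ ↦ by
        by_cases hzG : z ∈ G
        · exact Or.inl hzG
        · exact Or.inr (by by_cases hzw : z = w; exact Or.inr hzw; exact Or.inl ⟨hzG, hzw⟩)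
      exact NormedSpace.unbounded_univ ℝ ℂ ((hGb.union (hb.union Bornology.isBounded_singleton)).subset hsub)
    · exact h
  have hJU₁ : ∀ y ∈ frontier G, y ∉ U₁ := by
    intro y hy hyU
    by_cases hyw : y = w
    · have : w ∈ U₁ ∩ frontier U₁ := ⟨hyw ▸ hyU, by rw [hfr₁]; exact Or.inl ⟨1, ⟨zero_le_one, le_rfl⟩, hp1⟩⟩
      rw [hU₁o.inter_frontier_eq] at this
      exact this
    · have hyG : y ∉ G := fun h => by rw [hG.frontier_eq] at hy; exact hy.2 h
      exact Set.disjoint_left.1 hdisj hyU (hXU₂ ⟨hyG, hyw⟩)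
  -- the two sectors miss `E`
  have hsecE : ∀ {θa θb : ℝ}, (∀ t ∈ Ioo θa θb, (t ≠ θ₁ ∧ |t - θ₁| < 2 * π) ∧
      (t ≠ θ₂ ∧ |t - θ₂| < 2 * π)) → φ '' sector θa θb ⊆ U₁ ∪ U₂ := by
    intro θa θb hθ
    rw [hunion]
    rintro _ ⟨z, hz, rfl⟩ hzE
    have hzb : z ∈ ball (0 : ℂ) 1 := sector_subset_ball hz
    rcases hzE with ⟨s, hs, hps⟩ | ⟨s, hs, hqs⟩
    · rcases eq_or_lt_of_le hs.2 with rfl | hs1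
      · exact hwΩ (by rw [← hp1, hps]; exact φ.mapsTo hzb)
      · rw [hp_lt s ⟨hs.1, hs1⟩] at hps
        have := φ.injOn (hrad hx1 s ⟨hs.1, hs1⟩) hzb hps
        rw [hxθ] at this
        exact radius_not_mem_sector (fun t ht ↦ (hθ t ht).1) hs.1 (this ▸ hz)
    · rcases eq_or_lt_of_le hs.1 with h0 | hs0
      · exact hwΩ (by rw [← hq0, h0, hqs]; exact φ.mapsTo hzb)
      · rw [hq_gt s ⟨hs0, hs.2⟩] at hqs
        have := φ.injOn (hrad hx1' (1 - s) ⟨by linarith [hs.2], by linarith⟩) hzb hqs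
        rw [hx'θ] at this
        exact radius_not_mem_sector (fun t ht ↦ (hθ t ht).2) (by linarith [hs.2]) (this ▸ hz)
  have hθS₁ : ∀ t ∈ Ioo θ₁ θ₂, (t ≠ θ₁ ∧ |t - θ₁| < 2 * π) ∧ (t ≠ θ₂ ∧ |t - θ₂| < 2 * π) :=
    fun t ht ↦ ⟨⟨ht.1.ne', by rw [abs_sub_lt_iff]; constructor <;> linarith [ht.1, ht.2]⟩,
      ⟨ht.2.ne, by rw [abs_sub_lt_iff]; constructor <;> linarith [ht.1, ht.2, Real.pi_pos]⟩⟩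
  have hθS₂ : ∀ t ∈ Ioo θ₂ (θ₁ + 2 * π), (t ≠ θ₁ ∧ |t - θ₁| < 2 * π) ∧
      (t ≠ θ₂ ∧ |t - θ₂| < 2 * π) :=
    fun t ht ↦ ⟨⟨by linarith [ht.1], by rw [abs_sub_lt_iff]; constructor <;> linarith [ht.1, ht.2]⟩,
      ⟨ht.1.ne', by rw [abs_sub_lt_iff]; constructor <;> linarith [ht.1, ht.2]⟩⟩
  have hS₁ := (isPreconnected_sector.image _ (φ.continuousOn.mono sector_subset_ball)).subset_or_subset
    hU₁o hU₂o hdisj (hsecE hθS₁)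
  have hS₂ := (isPreconnected_sector.image _ (φ.continuousOn.mono sector_subset_ball)).subset_or_subset
    hU₁o hU₂o hdisj (hsecE hθS₂)
  -- frontier argument at `z₁ = p (1/2) = φ (x/2)`
  have hhalf : (1 / 2 : ℝ) ∈ Ico (0 : ℝ) 1 := ⟨by norm_num, by norm_num⟩
  set z₁ := p (1 / 2) with hz₁
  have hz₁E : z₁ ∈ E := Or.inl ⟨1 / 2, ⟨by norm_num, by norm_num⟩, rfl⟩
  have hz₁Ω : z₁ ∈ G := hpΩ _ hhalf
  obtain ⟨δ, hδ, hballΩ⟩ := Metric.isOpen_iff.1 hG z₁ hz₁Ω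
  have hcover : ∀ y ∈ ball z₁ δ, y ∉ E → y ∈ φ '' sector θ₁ θ₂ ∪ φ '' sector θ₂ (θ₁ + 2 * π) := by
    intro y hy hyE
    have hyΩ : y ∈ φ '' ball 0 1 := by rw [φ.bijOn.image_eq]; exact hballΩ hy
    obtain ⟨z, hz, rfl⟩ := hyΩ
    have hz0 : z ≠ 0 := by
      rintro rfl
      exact hyE (Or.inl ⟨0, ⟨le_rfl, zero_le_one⟩, hp0⟩)
    have hzn : ‖z‖ ∈ Ioo (0 : ℝ) 1 := ⟨norm_pos_iff.2 hz0, mem_ball_zero_iff.1 hz⟩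
    have h1 : z ≠ (‖z‖ : ℂ) * exp (θ₁ * I) := fun heq ↦ hyE (Or.inl ⟨‖z‖, ⟨hzn.1.le, hzn.2.le⟩, by
      rw [hp_lt _ ⟨hzn.1.le, hzn.2⟩, hxθ, ← heq]⟩)
    have h2 : z ≠ (‖z‖ : ℂ) * exp (θ₂ * I) := fun heq ↦ hyE (Or.inr ⟨1 - ‖z‖,
      ⟨by linarith [hzn.2], by linarith [hzn.1]⟩, by
        rw [hq_gt _ ⟨by linarith [hzn.2], by linarith [hzn.1]⟩, hx'θ, sub_sub_cancel, ← heq]⟩)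
    rcases mem_sector_or hz hz0 h1 h2 with h | h
    · exact Or.inl ⟨z, h, rfl⟩
    · exact Or.inr ⟨z, h, rfl⟩
  have hz₁fr : z₁ ∈ frontier U₁ := by rw [hfr₁]; exact hz₁E
  have hz₁fr' : z₁ ∈ frontier U₂ := by rw [hfr₂]; exact hz₁E
  obtain ⟨y₁, hy₁U, hy₁d⟩ := Metric.mem_closure_iff.1 (frontier_subset_closure hz₁fr) δ hδ
  obtain ⟨y₂, hy₂U, hy₂d⟩ := Metric.mem_closure_iff.1 (frontier_subset_closure hz₁fr') δ hδ
  have hnotE : ∀ y ∈ U₁ ∪ U₂, y ∉ E := fun y hy hyE ↦ by rw [hunion] at hy; exact hy hyE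
  have hy₁S := hcover y₁ (mem_ball'.2 hy₁d) (hnotE y₁ (Or.inl hy₁U))
  have hy₂S := hcover y₂ (mem_ball'.2 hy₂d) (hnotE y₂ (Or.inr hy₂U))
  -- one of the two sectors is mapped into the bounded component `U₁`
  have hsome : ∃ θa θb : ℝ, θa < θb ∧
      (∀ t ∈ Ioo θa θb, (t ≠ θ₁ ∧ |t - θ₁| < 2 * π) ∧ (t ≠ θ₂ ∧ |t - θ₂| < 2 * π)) ∧
      φ '' sector θa θb ⊆ U₁ := by
    rcases hS₁ with h1 | h1
    · exact ⟨θ₁, θ₂, h12, hθS₁, h1⟩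
    rcases hS₂ with h2 | h2
    · exact ⟨θ₂, θ₁ + 2 * π, h21, hθS₂, h2⟩
    exfalso
    have : y₁ ∈ U₂ := hy₁S.elim (fun h ↦ h1 h) (fun h ↦ h2 h)
    exact Set.disjoint_left.1 hdisj hy₁U this
  clear hy₂S hy₂d hy₂U y₂
  obtain ⟨θa, θb, hab, hθ, hSU⟩ := hsome
  -- the extension is `w` on the arc `(θa, θb)`
  have harc : ∀ t ∈ Ioo θa θb, Φ (exp (t * I)) = w := by
    intro t ht
    have he : ‖exp (t * I)‖ = 1 := norm_exp_ofReal_mul_I t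
    have hlim := tendsto_extendFrom_radial' φ hΦc he
    have hcl : Φ (exp (t * I)) ∈ closure U₁ := by
      refine mem_closure_of_tendsto hlim ?_
      filter_upwards [Ioo_mem_nhdsLT one_pos] with ρ hρ
      have hmem : (ρ : ℂ) * exp (t * I) ∈ sector θa θb := ⟨(ρ, t), ⟨hρ, ht⟩, rfl⟩
      have : Φ ((ρ : ℂ) * exp (t * I)) = φ ((ρ : ℂ) * exp (t * I)) :=
        extendFrom_extends φ.continuousOn _ (sector_subset_ball hmem)
      have hmemU : φ ((ρ : ℂ) * exp (t * I)) ∈ U₁ := hSU ⟨_, hmem, rfl⟩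
      rw [← this] at hmemU
      exact hmemU
    have hJ' : Φ (exp (t * I)) ∈ frontier G :=
      extendFrom_mem_frontier' φ hG he (htend _ (mem_closedBall_zero_iff.2 he.le))
    rw [closure_eq_self_union_frontier, hfr₁] at hcl
    rcases hcl with h | h
    · exact absurd h (hJU₁ _ hJ')
    · rcases hEsub h with h' | h'
      · exact absurd h' (fun h'' => by rw [hG.frontier_eq] at hJ'; exact hJ'.2 h'')
      · exact h'
  -- boundary uniqueness: `Φ - w` vanishes on an arc, hence `φ 0 = w`, absurd
  obtain ⟨U, hUo, hUne, hUarc⟩ := exists_isOpen_arc hab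
  have hdc : DiffContOnCl ℂ (fun z ↦ Φ z - w) (ball (0 : ℂ) 1) := by
    refine DiffContOnCl.sub ⟨?_, ?_⟩ diffContOnCl_const
    · exact φ.differentiableOn.congr fun z hz ↦ extendFrom_extends φ.continuousOn _ hz
    · rw [closure_ball 0 one_ne_zero]; exact hΦc
  have hzero := Complex.eqOn_zero_of_diffContOnCl_ball_of_eqOn_arc hdc hUo hUne (fun z hz ↦ by
    obtain ⟨t, ht, rfl⟩ := hUarc z hz
    simp only [harc t ht, sub_self])
  have h0 : Φ 0 - w = 0 := hzero (mem_closedBall_self zero_le_one)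
  rw [hΦ0, sub_eq_zero] at h0
  exact hwΩ (h0 ▸ φ.mapsTo (mem_ball_self one_pos))

end Extension

/-- **Registered sub-goal `stub_carvedReduction_oneSidedInjective`** (crux item stmt-CriticalPhenomena-14005,
stub 5a4″ `stub_carvedReduction_squeezeSolid`, piece (M3c) ONE-SIDED BOUNDARY POINTS HAVE ONE
PREIMAGE): for a conformal equivalence `ψ : 𝔻 → G` onto a bounded open `G` with the uniform-continuum
property `hlc`, a frontier point `w` with `Gᶜ ∖ {w}` connected has at most one preimage on the unit
circle under `extendFrom 𝔻 ψ`. [cite: PommerenkeBBCM1992, Thm. 2.6 (injectivity step), Thm. 2.1] -/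
theorem stub_carvedReduction_oneSidedInjective :
    ∀ (G : Set ℂ) (ψ : ConformalEquiv (ball (0 : ℂ) 1) G) (w : ℂ), IsOpen G → Bornology.IsBounded G →
      (∀ ε > (0 : ℝ), ∃ δ > (0 : ℝ), ∀ a ∈ frontier G, ∀ b ∈ frontier G, dist a b < δ →
        ∃ σ ⊆ Gᶜ, IsCompact σ ∧ IsPreconnected σ ∧ a ∈ σ ∧ b ∈ σ ∧ σ ⊆ closedBall a ε) →
      IsConnected (Gᶜ \ {w}) →
      (sphere (0 : ℂ) 1 ∩ (extendFrom (ball 0 1) ψ) ⁻¹' {w}).Subsingleton := by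
  intro G ψ w hG hGb hlc hcut
  obtain ⟨hΦc, -, htend⟩ := ψ.continuousOn_extendFrom_of_lc hG hGb hlc
  rintro x ⟨hx, hxw⟩ x' ⟨hx', hx'w⟩
  have hxw : extendFrom (ball 0 1) ψ x = w := hxw
  have hx'w : extendFrom (ball 0 1) ψ x' = w := hx'w
  exact eq_of_extendFrom_eq_of_nonCut ψ hG hGb hΦc htend (mem_sphere_zero_iff_norm.1 hx)
    (mem_sphere_zero_iff_norm.1 hx') (hxw.trans hx'w.symm) (hxw ▸ hcut)

end Summit.CriticalPhenomena.SAWScalingLimit.Theorems.ObservableToSLER.Squeeze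
end
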